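import Literature.MathematicalPhysics.QuantumFieldTheory.Balaban1983to89.B13RealSliceEntryLetters
import Summits.QuantumFields.YangMills.Theorems.UnitScaleTiltProp7AnalyticRemainderInputs
import Mathlib.Analysis.Calculus.MeanValue
import HarnessLib

/-!
# Route `UnitScaleTilt`, crux stmt-QuantumFields-20520 `FluctuationComparisonRegPrIntL`, PATH-B organ (covariant organ of record,
# RULING №56), row D0 ∕ letter (Dwhite∣MW) of ✓(L50b) `…OrganTangentD0ChartLettersWhitened` — **LETTERS DIFFERENTIATE: THE WHITENING
# KERNEL IS LIPSCHITZ IN THE BACKGROUND.**  A matrix family holomorphic in a complex background parameter with an ENTRYWISE MAJORANT on a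
# complex ball is entrywise ∕ row-sum ∕ matrix–vector LIPSCHITZ in that parameter on the half ball (Cauchy); docked on lit's letter structure
# `RawEntryLetters` and on print's SQUARE-ROOT KERNEL `(C*Δ_kC)^{−1∕2} = π^{−1}∫₀^∞ x^{−1∕2}(x + C*Δ_kC)^{−1}dx` ([Balaban1988RG2Cluster] (2.7) p.13) through
# lit ✓`B13RealSliceEntryLetters.rawEntryLetters_invSqrt_of_realSlice`: the analytic skeleton of the (Dwhite) letter `kW e`.

Cell `ym3-torus`, WIDTH COPY «width 19» of ★p1 (seat `ym3-torus-px19`, gen 23); `--supports stmt-QuantumFields-20520 --as helper`; count-neutral;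
def-free.  Sibling of ✓p827474 `…OrganTangentResolventDoubleDifference` (LEAD w3 g28: the SECOND-difference algebra of (xv)); this file is the
FIRST-difference ∕ square-root side that (L50b)'s (Dwhite∣MW) names («`kW e` = z-window × row-sum over `e′` of `∂_B K_V^{−1∕2}(e,e′)`», LEAD №19).

INHABITATION (★★OWNER RULING №100): LAW-FREE — the family is `u ↦ K_{V_u}` (the fluctuation operator of the whitened covariant chart) along the
COMPLEXIFIED coarse one-bond move `V_u = update V b (V b·expPointC(u•ŵ))` (✓p827459's slice device), `invSqrt` its whitening kernel; own
analyticity; no fibre law, no score, no cross-law object.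

THE PRINT.  [Balaban1988RG2Cluster] (CMP 116) (2.7) p.13: «This construction was discussed in [13] for all operators determining Δ_k, and for
C^{(k)}(Z₀), but not for (C^{(k)})^{1∕2} … `(C^{(k)})^{1∕2} = (C*Δ_kC)^{−1∕2} = (1∕π)∫₀^∞ dx x^{−1∕2}(xI + C*Δ_kC)^{−1}` … The resolvent … can
be expanded into a generalized random walk expansion. This yields an expansion of … `(C^{(k)})^{1∕2}` also»; p.15 «For the pair (U,0) the
operators are symmetric … The general case is handled by a perturbative argument»; [Balaban1985BackgroundPropagators] Thm 3.4 p.400 («can be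
extended to analytic functions … small perturbations of the operators depending on U only»), Thm 3.10 (3.107)–(3.108) p.416 (entrywise decay).
Tree: ✓`B13Sqrt27` ((2.7) kernel-checked; the series term's missing `1∕π` refuted), ✓`B13Sqrt27Accretive` (`invSqrt`, holomorphy ∕ bound from ONE
accretivity margin), ✓`B13RealSliceEntryLetters` (T-58.3′: complex-ball `RawEntryLetters` of `u ↦ invSqrt (A u)` from holomorphy + accretivity + REAL-slice
decay, two-constants theorem).

WHAT THIS FILE PROVES (sorry-free, def-free; `E` any complex normed space = the complexified chart parameter; `p` a finite index = bonds).
* §1 ★`norm_sub_le_of_differentiableOn_bound` — CAUCHY ⟹ LIPSCHITZ: `F : E → 𝒳` ℂ-differentiable on `ball 0 R` with `‖F u‖ ≤ M` there is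
  `(4M∕R)`-Lipschitz on `ball 0 (R∕2)` (✓`Prop7AnalyticRemainderInputs.norm_fderiv_le_of_bound` + Mathlib's convex mean-value inequality).
* §2 ★★`entry_lip_of_majorant`, ★★`rowSum_lip_of_majorant`, ★★`mulVec_lip_of_majorant` — for `F : E → Matrix p p ℂ` entrywise holomorphic on
  `ball 0 R` with an entrywise majorant `‖F u i j‖ ≤ D i j`: on `ball 0 (R∕2)`, `‖F u′ i j − F u i j‖ ≤ (4·D i j∕R)·‖u′ − u‖`,
  `Σ_j ‖F u′ i j − F u i j‖ ≤ (4∕R)·(Σ_j D i j)·‖u′ − u‖`, `‖((F u′ − F u) *ᵥ z) i‖ ≤ (4∕R)·(Σ_j D i j)·Z·‖u′ − u‖` for `‖z j‖ ≤ Z`.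
* §3 ★★`rawEntryLetters_rowSum_lip` — §2 read on lit's `RawEntryLetters Δ loc R ρ B` (`D i j = B·e^{−ρ·tdist1(loc i, loc j)}`).
* §4 ★★★`whiteningKernel_rowSum_lip` — DOCKED ON PRINT'S SQUARE ROOT: the hypotheses of lit ✓`rawEntryLetters_invSqrt_of_realSlice`
  (holomorphic `u ↦ A u`, ONE accretivity margin `m > 0` on `ball 0 R`, REAL-slice decay `‖invSqrt (A v) i j‖ ≤ B e^{−ρ d(i,j)}`) ⟹ on
  `ball 0 (R′∕2)`, `R′ = (r∕(1+r))R`: `Σ_j ‖invSqrt (A u′) i j − invSqrt (A u) i j‖ ≤ (4B′∕R′)·(Σ_j e^{−ρ′ d(i,j)})·‖u′ − u‖`, `B′ = B^{1−λ(r)}(max B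
  (2∕√m))^{λ(r)}`, `ρ′ = (1 − λ(r))ρ` — (Dwhite)'s `kW e := (4B′∕R′)·(Σ_{e′} e^{−ρ′ d(e,e′)})·(z-window)` BY NAME, with NO measurability ∕ MW premise
  (holomorphy replaces it); m-UNIFORM iff `(m, B, ρ, R)` are — the [Balaban1985BackgroundPropagators] multi-level curved letters (UV3-NODE §62 (e)),
  NOT discharged here.  ★★`whiteningKernel_mulVec_lip`: the matrix–vector form.

HONEST SCOPE.  Generic complex analysis (Cauchy estimate + mean value) over lit's kernel-checked letters; nothing of Bałaban's operators is
constructed; (Dwhite)'s INPUTS (holomorphy of `K_V` in the complexified chart, an m-uniform accretivity margin, real-slice decay of `K_V^{−1∕2}`)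
stay HYPOTHESIS letters; (Dmin), (Dwhite∣MW), (χ-Lip∣MW), rows v0.1–v0.4 UNDISCHARGED; the five registered stubs, 20520, 19936, 19200, `YM3TorusSU2`
NOT proved; no summit is proved by a helper.  R3 = SU(2) YM₃ on T³ — NOT d = 4, NOT infinite volume, NOT a mass gap, NOT Clay; the Yang–Mills mass
gap is NOT proved.

References: T. Bałaban, CMP **116** (1988) 1–22 [Balaban1988RG2Cluster] ((2.7) p.13, p.15); CMP **99** (1985) 389–434 [Balaban1985BackgroundPropagators]
(Thm 3.4 p.400, Thm 3.10 (3.108) p.416); CMP **109** (1987) 249–301 [Balaban1987RG1] ((1.13) p.262, (1.18) p.263).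
-/

noncomputable section

open Metric Set Finset
open scoped Matrix
open Literature.MathematicalPhysics.QuantumFieldTheory.Balaban1983to89
open Literature.MathematicalPhysics.QuantumFieldTheory.Balaban1983to89.B9Thm37GlueTorus (tdist1)
open Literature.MathematicalPhysics.QuantumFieldTheory.Balaban1983to89.B5TorusCover (UT)
open Literature.MathematicalPhysics.QuantumFieldTheory.Balaban1983to89.B13EntrywiseWalks (RawEntryLetters)
open Literature.MathematicalPhysics.QuantumFieldTheory.Balaban1983to89.B13Sqrt27Accretive (invSqrt)
open Literature.MathematicalPhysics.QuantumFieldTheory.Balaban1983to89.B13RealSliceEntryLetters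
  (RealStructure lam rawEntryLetters_invSqrt_of_realSlice)
open Summit.QuantumFields.YangMills.Theorems.Prop7AnalyticRemainderInputs (norm_fderiv_le_of_bound)

namespace Summit.QuantumFields.YangMills.Theorems.OrganTangentWhiteningKernelLipOfLetters

variable {E : Type*} [NormedAddCommGroup E] [NormedSpace ℂ E]

/-! ## §1 Cauchy ⟹ Lipschitz on the half ball -/

/-- ★ **CAUCHY ⟹ LIPSCHITZ**: a map ℂ-differentiable on `ball 0 R` and bounded by `M` there is `(4M∕R)`-Lipschitz on `ball 0 (R∕2)`
(the derivative is `≤ 4M∕R` on the half ball by ✓`norm_fderiv_le_of_bound`; then the mean-value inequality on the convex half ball).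
[cite: Balaban1985BackgroundPropagators, Thm 3.4 p.400] -/
theorem norm_sub_le_of_differentiableOn_bound {𝒳 : Type*} [NormedAddCommGroup 𝒳] [NormedSpace ℂ 𝒳]
    {F : E → 𝒳} {R M : ℝ} (hR : 0 < R)
    (hF : DifferentiableOn ℂ F (ball (0 : E) R)) (hM : ∀ u ∈ ball (0 : E) R, ‖F u‖ ≤ M)
    {u u' : E} (hu : ‖u‖ < R / 2) (hu' : ‖u'‖ < R / 2) :
    ‖F u' - F u‖ ≤ (4 * M / R) * ‖u' - u‖ := by
  have hsub : ball (0 : E) (R / 2) ⊆ ball (0 : E) R := ball_subset_ball (by linarith)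
  have hdiff : ∀ x ∈ ball (0 : E) (R / 2), DifferentiableAt ℂ F x := fun x hx =>
    (hF x (hsub hx)).differentiableAt (isOpen_ball.mem_nhds (hsub hx))
  have hbd : ∀ x ∈ ball (0 : E) (R / 2), ‖fderiv ℂ F x‖ ≤ 4 * M / R := fun x hx =>
    norm_fderiv_le_of_bound hR hF hM (mem_ball_zero_iff.mp hx)
  exact (convex_ball (0 : E) (R / 2)).norm_image_sub_le_of_norm_fderiv_le hdiff hbd
    (mem_ball_zero_iff.mpr hu) (mem_ball_zero_iff.mpr hu')

/-! ## §2 Matrix families with an entrywise majorant -/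

section Majorant

variable {p : Type} [Fintype p]

omit [Fintype p] in
/-- ★★ **ENTRYWISE LIPSCHITZ FROM AN ENTRYWISE MAJORANT**: `‖F u′ i j − F u i j‖ ≤ (4·D i j∕R)·‖u′ − u‖` on the half ball.
[cite: Balaban1985BackgroundPropagators, Thm 3.10 (3.108) p.416] -/
theorem entry_lip_of_majorant {F : E → Matrix p p ℂ} {R : ℝ} (hR : 0 < R) {D : p → p → ℝ}
    (hholo : ∀ i j, DifferentiableOn ℂ (fun u => F u i j) (ball (0 : E) R))
    (hmaj : ∀ u ∈ ball (0 : E) R, ∀ i j, ‖F u i j‖ ≤ D i j)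
    {u u' : E} (hu : ‖u‖ < R / 2) (hu' : ‖u'‖ < R / 2) (i j : p) :
    ‖F u' i j - F u i j‖ ≤ (4 * D i j / R) * ‖u' - u‖ :=
  norm_sub_le_of_differentiableOn_bound (F := fun u => F u i j) hR (hholo i j) (fun u hu => hmaj u hu i j) hu hu'

/-- ★★ **ROW-SUM LIPSCHITZ**: `Σ_j ‖F u′ i j − F u i j‖ ≤ (4∕R)·(Σ_j D i j)·‖u′ − u‖` on the half ball.
[cite: Balaban1985BackgroundPropagators, Thm 3.10 (3.108) p.416] -/
theorem rowSum_lip_of_majorant {F : E → Matrix p p ℂ} {R : ℝ} (hR : 0 < R) {D : p → p → ℝ}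
    (hholo : ∀ i j, DifferentiableOn ℂ (fun u => F u i j) (ball (0 : E) R))
    (hmaj : ∀ u ∈ ball (0 : E) R, ∀ i j, ‖F u i j‖ ≤ D i j)
    {u u' : E} (hu : ‖u‖ < R / 2) (hu' : ‖u'‖ < R / 2) (i : p) :
    ∑ j, ‖F u' i j - F u i j‖ ≤ (4 / R) * (∑ j, D i j) * ‖u' - u‖ := by
  calc ∑ j, ‖F u' i j - F u i j‖ ≤ ∑ j, (4 * D i j / R) * ‖u' - u‖ :=
        Finset.sum_le_sum fun j _ => entry_lip_of_majorant hR hholo hmaj hu hu' i j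
    _ = (4 / R) * (∑ j, D i j) * ‖u' - u‖ := by rw [Finset.mul_sum, Finset.sum_mul]; exact Finset.sum_congr rfl fun j _ => by ring

/-- ★★ **MATRIX–VECTOR LIPSCHITZ** (the (Dwhite) reading: `Wh u z e − Wh u′ z e = Σ_{e′}(F u − F u′)_{e e′} z_{e′}`): for `‖z j‖ ≤ Z`,
`‖((F u′ − F u) *ᵥ z) i‖ ≤ (4∕R)·(Σ_j D i j)·Z·‖u′ − u‖` on the half ball. [cite: Balaban1988RG2Cluster, (2.7) p.13] -/
theorem mulVec_lip_of_majorant {F : E → Matrix p p ℂ} {R : ℝ} (hR : 0 < R) {D : p → p → ℝ}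
    (hholo : ∀ i j, DifferentiableOn ℂ (fun u => F u i j) (ball (0 : E) R))
    (hmaj : ∀ u ∈ ball (0 : E) R, ∀ i j, ‖F u i j‖ ≤ D i j)
    {u u' : E} (hu : ‖u‖ < R / 2) (hu' : ‖u'‖ < R / 2) {z : p → ℂ} {Z : ℝ} (hZ : 0 ≤ Z) (hz : ∀ j, ‖z j‖ ≤ Z) (i : p) :
    ‖((F u' - F u) *ᵥ z) i‖ ≤ (4 / R) * (∑ j, D i j) * Z * ‖u' - u‖ := by
  rw [Matrix.mulVec, dotProduct]
  calc ‖∑ j, (F u' - F u) i j * z j‖ ≤ ∑ j, ‖(F u' - F u) i j * z j‖ := norm_sum_le _ _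
    _ ≤ ∑ j, ‖F u' i j - F u i j‖ * Z := Finset.sum_le_sum fun j _ => by
        rw [norm_mul, Matrix.sub_apply]
        exact mul_le_mul_of_nonneg_left (hz j) (norm_nonneg _)
    _ = (∑ j, ‖F u' i j - F u i j‖) * Z := (Finset.sum_mul _ _ _).symm
    _ ≤ ((4 / R) * (∑ j, D i j) * ‖u' - u‖) * Z :=
        mul_le_mul_of_nonneg_right (rowSum_lip_of_majorant hR hholo hmaj hu hu' i) hZ
    _ = (4 / R) * (∑ j, D i j) * Z * ‖u' - u‖ := by ring

end Majorant

/-! ## §3 Read on lit's letter structure `RawEntryLetters` -/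

section Letters

variable {ν : ℕ} {Nf : Fin ν → ℕ} [∀ i, NeZero (Nf i)]
variable {p : Type} [Fintype p] [DecidableEq p]

omit [DecidableEq p] in
/-- ★★ **`RawEntryLetters` DIFFERENTIATE**: a family carrying lit's complex-ball entry letters (entrywise holomorphy on `ball 0 R`, decay
majorant `B·e^{−ρ·tdist1(loc i, loc j)}`) has row sums Lipschitz in the parameter on the half ball:
`Σ_j ‖Δ u′ i j − Δ u i j‖ ≤ (4∕R)·(Σ_j B·e^{−ρ d(i,j)})·‖u′ − u‖`. [cite: Balaban1985BackgroundPropagators, Thm 3.10 (3.108) p.416] -/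
theorem rawEntryLetters_rowSum_lip {Δ : E → Matrix p p ℂ} {loc : p → UT Nf} {R ρ B : ℝ} (hR : 0 < R)
    (h : RawEntryLetters Δ loc R ρ B) {u u' : E} (hu : ‖u‖ < R / 2) (hu' : ‖u'‖ < R / 2) (i : p) :
    ∑ j, ‖Δ u' i j - Δ u i j‖
      ≤ (4 / R) * (∑ j, B * Real.exp (-(ρ * tdist1 Nf (loc i) (loc j)))) * ‖u' - u‖ :=
  rowSum_lip_of_majorant hR h.holo h.decay hu hu' i

omit [Fintype p] [DecidableEq p] in
/-- ★★ The entrywise form on `RawEntryLetters`. [cite: Balaban1985BackgroundPropagators, Thm 3.10 (3.108) p.416] -/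
theorem rawEntryLetters_entry_lip {Δ : E → Matrix p p ℂ} {loc : p → UT Nf} {R ρ B : ℝ} (hR : 0 < R)
    (h : RawEntryLetters Δ loc R ρ B) {u u' : E} (hu : ‖u‖ < R / 2) (hu' : ‖u'‖ < R / 2) (i j : p) :
    ‖Δ u' i j - Δ u i j‖ ≤ (4 * (B * Real.exp (-(ρ * tdist1 Nf (loc i) (loc j)))) / R) * ‖u' - u‖ :=
  entry_lip_of_majorant hR h.holo h.decay hu hu' i j

/-! ## §4 Docked on print's square root: the whitening kernel `u ↦ invSqrt (A u)` -/

/-- ★★★ **THE WHITENING KERNEL IS ROW-SUM LIPSCHITZ IN THE BACKGROUND** — the analytic skeleton of (Dwhite)'s `kW e`.  Under the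
hypotheses of lit ✓`rawEntryLetters_invSqrt_of_realSlice` — `u ↦ A u` entrywise holomorphic on `ball 0 R`, ONE accretivity margin `m > 0` there,
REAL-slice decay `‖invSqrt (A v) i j‖ ≤ B·e^{−ρ d(i,j)}` for real `v` in the ball ([Balaban1988RG2Cluster] (2.7) p.13 ∕ p.15; [Balaban1985BackgroundPropagators]
Thm 3.4, Thm 3.10) — the square-root kernel's ROW SUMS are Lipschitz in `u` on `ball 0 (R′∕2)`, `R′ = (r∕(1+r))·R`:
`Σ_j ‖invSqrt (A u′) i j − invSqrt (A u) i j‖ ≤ (4∕R′)·(Σ_j B′·e^{−ρ′ d(i,j)})·‖u′ − u‖`, `B′ = B^{1−λ(r)}·(max B (2∕√m))^{λ(r)}`, `ρ′ = (1−λ(r))·ρ`.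
[cite: Balaban1988RG2Cluster, (2.7) p.13; Balaban1985BackgroundPropagators, Thm 3.10 (3.108) p.416] -/
theorem whiteningKernel_rowSum_lip (ℛ : RealStructure E) {A : E → Matrix p p ℂ} {loc : p → UT Nf}
    {R m ρ B r : ℝ} (hR : 0 < R) (hm : 0 < m)
    (hA : ∀ i j, DifferentiableOn ℂ (fun u => A u i j) (ball (0 : E) R))
    (hacc : ∀ u ∈ ball (0 : E) R, ∀ v : p → ℂ, m * ∑ i, ‖v i‖ ^ 2 ≤ (∑ i, star (v i) * (A u *ᵥ v) i).re)
    (hreal : ∀ v ∈ ℛ.Ereal, ‖v‖ < R → ∀ i j,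
      ‖invSqrt (A v) i j‖ ≤ B * Real.exp (-(ρ * tdist1 Nf (loc i) (loc j))))
    (hB0 : 0 ≤ B) (hρ : 0 ≤ ρ) (hr0 : 0 < r) (hr1 : r < 1)
    {u u' : E} (hu : ‖u‖ < r / (1 + r) * R / 2) (hu' : ‖u'‖ < r / (1 + r) * R / 2) (i : p) :
    ∑ j, ‖invSqrt (A u') i j - invSqrt (A u) i j‖
      ≤ (4 / (r / (1 + r) * R)) *
          (∑ j, (B ^ (1 - lam r) * (max B (2 / Real.sqrt m)) ^ lam r) *
            Real.exp (-((1 - lam r) * ρ * tdist1 Nf (loc i) (loc j)))) * ‖u' - u‖ := by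
  have hL := rawEntryLetters_invSqrt_of_realSlice ℛ hm hA hacc hreal hB0 hρ hr0 hr1
  have hR' : 0 < r / (1 + r) * R := by positivity
  exact rawEntryLetters_rowSum_lip hR' hL (by simpa [div_div] using hu) (by simpa [div_div] using hu') i

/-- ★★ **THE MATRIX–VECTOR FORM** ((Dwhite)'s letter shape: `‖Wh u′ z e − Wh u z e‖ ≤ kW e·‖u′ − u‖` for `‖z‖_∞ ≤ Z`, with
`kW e := (4∕R′)·(Σ_{e′} B′ e^{−ρ′ d(e,e′)})·Z`). [cite: Balaban1988RG2Cluster, (2.7) p.13; Balaban1985BackgroundPropagators, Thm 3.10 (3.108) p.416] -/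
theorem whiteningKernel_mulVec_lip (ℛ : RealStructure E) {A : E → Matrix p p ℂ} {loc : p → UT Nf}
    {R m ρ B r : ℝ} (hR : 0 < R) (hm : 0 < m)
    (hA : ∀ i j, DifferentiableOn ℂ (fun u => A u i j) (ball (0 : E) R))
    (hacc : ∀ u ∈ ball (0 : E) R, ∀ v : p → ℂ, m * ∑ i, ‖v i‖ ^ 2 ≤ (∑ i, star (v i) * (A u *ᵥ v) i).re)
    (hreal : ∀ v ∈ ℛ.Ereal, ‖v‖ < R → ∀ i j,
      ‖invSqrt (A v) i j‖ ≤ B * Real.exp (-(ρ * tdist1 Nf (loc i) (loc j))))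
    (hB0 : 0 ≤ B) (hρ : 0 ≤ ρ) (hr0 : 0 < r) (hr1 : r < 1)
    {u u' : E} (hu : ‖u‖ < r / (1 + r) * R / 2) (hu' : ‖u'‖ < r / (1 + r) * R / 2)
    {z : p → ℂ} {Z : ℝ} (hZ : 0 ≤ Z) (hz : ∀ j, ‖z j‖ ≤ Z) (i : p) :
    ‖((invSqrt (A u') - invSqrt (A u)) *ᵥ z) i‖
      ≤ (4 / (r / (1 + r) * R)) *
          (∑ j, (B ^ (1 - lam r) * (max B (2 / Real.sqrt m)) ^ lam r) *
            Real.exp (-((1 - lam r) * ρ * tdist1 Nf (loc i) (loc j)))) * Z * ‖u' - u‖ := by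
  have hL := rawEntryLetters_invSqrt_of_realSlice ℛ hm hA hacc hreal hB0 hρ hr0 hr1
  have hR' : 0 < r / (1 + r) * R := by positivity
  exact mulVec_lip_of_majorant (F := fun u => invSqrt (A u)) hR' hL.holo hL.decay
    (by simpa [div_div] using hu) (by simpa [div_div] using hu') hZ hz i

end Letters

end Summit.QuantumFields.YangMills.Theorems.OrganTangentWhiteningKernelLipOfLetters
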